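import Literature.NumberTheory.EllipticCurves.CMNewformGamma0EulerFactorsPadicCharacter
import Literature.NumberTheory.EllipticCurves.CMNewformGamma0NebentypusProofs
import Literature.NumberTheory.EllipticCurves.CMNewformOfHeckeCharacterProofs
import Literature.NumberTheory.EllipticCurves.ComplexMultiplicationDeuringRamifiedProofs
import Literature.NumberTheory.EllipticCurves.HeckeLFunctionEqLSeriesOfLocalFactors
import HarnessLib

/-!
# The Euler factors of the `Γ₀` CM newform through the `p`-adic character at the GOOD primes `ℓ ∤ p·|d_K|·N𝔪·M` — proofs

Topic `NumberTheory/EllipticCurves`; namespace `Literature.NumberTheory.EllipticCurves.ModularForms`. THEOREMS ONLY (no definition, no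
named fact, no `sorry`). Companion of the named fact `Ribet1977_cmNewform_gamma0_eulerFactor_padicCharacter`
(`CMNewformGamma0EulerFactorsPadicCharacter.lean`), which asserts, for EVERY prime `ℓ ≠ p`, the identity
`1 − C(ι a_ℓ(g)) X + 𝟙_{ℓ∤M} C(ℓ) X² = ∏_{w ∋ ℓ, θ unramified at w} (1 − C(θ(Frob_w)₀₀) X^{f(w∣ℓ)})`. This file PROVES the identity at every
prime `ℓ ∤ p·|d_K|·N𝔪` not dividing the level `M` from the hypotheses of the fact alone — no print input: at such `ℓ` every place
`w ∋ ℓ` is prime to `𝔪`, so `θ` is unramified at `w` with `θ(Frob_w)₀₀ = e⁻¹ψ(w)` (the pinning hypothesis), `ι a_ℓ(g) = e⁻¹(Σ_{Nw=ℓ} ψ w)`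
(the coefficient hypothesis), and the decomposition law of the quadratic field (`placesOver_trichotomy_of_finrank_eq_two`; `ℓ ∤ d_K` excludes
ramification by Dedekind's discriminant theorem `natGenerator_dvd_discr_of_ramificationIdx_eq_two`) together with Ribet's `η = φ`
(`idealPow_span_natCast_eq_kroneckerChar_mul_pow`: `ψ((ℓ)) = κ(ℓ)·ℓ`, `κ(ℓ) = ±1` at split / inert `ℓ`, `kroneckerChar_natGenerator_eq_(neg_)one_of_…`)
give: split `ℓ = w w̄`: `(1 − ψ(w)X)(1 − ψ(w̄)X) = 1 − (ψ(w)+ψ(w̄))X + ℓX²`; inert: `1 − ψ((ℓ))X² = 1 + ℓX²` and `Σ_{Nw=ℓ} = 0`.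
So the print content of the fact is confined to the primes `ℓ ∣ |d_K|·N𝔪·M` (the level of `g` and the Euler factors at the conductor).

* `eulerFactor_padicCharacter_of_not_dvd` — the identity at `ℓ ∤ p·|d_K|·N𝔪`, `ℓ ∤ M`.
* (sequel `…ProofsResidual.lean`) the named fact FROM its print residue `Ribet1977_cmNewform_gamma0_level_and_badEulerFactor_padicCharacter`
  (file `…Residual.lean`: the level primes divide `|d_K|·N𝔪`, and the identity at the primes of `|d_K|·N𝔪`).

References: [Ribet1977Nebentypus] §3 Thm. (3.4), Cor. (3.5) (LNM 601 pp. 34–35); [NeukirchANT1999] Ch. I (8.2)–(8.3), Ch. III (2.12); [Cox2013] §1.C Lemma 1.14;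
[SerreAbelianLadic1968] Ch. I §2.3.
-/

noncomputable section

open scoped NumberField ModularForm MatrixGroups
open NumberField IsDedekindDomain CongruenceSubgroup Polynomial Rat.HeightOneSpectrum
open Literature.NumberTheory.GaloisRepresentations Literature.NumberTheory.LFunctions
  Literature.NumberTheory.Automorphic Literature.NumberTheory.EllipticCurves

namespace Literature.NumberTheory.EllipticCurves.ModularForms

section Good

variable {K : Type} [Field K] [NumberField K]

/-- Two distinct rational primes do not lie in one prime of `𝓞 K` (Bézout). [cite: NeukirchANT1999, Ch. I §3] -/
theorem natCast_not_mem_asIdeal_of_natCast_mem {w : HeightOneSpectrum (𝓞 K)} {ℓ q : ℕ} (hℓ : ℓ.Prime) (hq : q.Prime) (hne : ℓ ≠ q)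
    (hℓw : (ℓ : 𝓞 K) ∈ w.asIdeal) : (q : 𝓞 K) ∉ w.asIdeal := fun hqw ↦ by
  have hb := Nat.gcd_eq_gcd_ab ℓ q
  rw [Nat.Coprime.gcd_eq_one ((Nat.coprime_primes hℓ hq).mpr hne)] at hb
  have h1 : (1 : 𝓞 K) = (ℓ : 𝓞 K) * (ℓ.gcdA q : 𝓞 K) + (q : 𝓞 K) * (ℓ.gcdB q : 𝓞 K) := by exact_mod_cast congrArg (Int.cast : ℤ → 𝓞 K) hb
  exact w.isPrime.ne_top ((Ideal.eq_top_iff_one _).mpr (h1 ▸ w.asIdeal.add_mem (w.asIdeal.mul_mem_right _ hℓw) (w.asIdeal.mul_mem_right _ hqw)))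

/-- A place `w` of `K` over the rational place `v` with `ℓ_v ∤ N𝔪` is prime to `𝔪` (`N(w) = ℓ_v^{f} ∣ N𝔪` otherwise). [cite: NeukirchANT1999, Ch. I (8.2)] -/
theorem not_le_asIdeal_of_not_dvd_absNorm {𝔪 : Ideal (𝓞 K)} {v : HeightOneSpectrum (𝓞 ℚ)} (hℓ : ¬ natGenerator v ∣ Ideal.absNorm 𝔪)
    {w : HeightOneSpectrum (𝓞 K)} (hw : w.under (𝓞 ℚ) = v) : ¬ 𝔪 ≤ w.asIdeal := fun hle ↦ by
  have hdvd : Ideal.absNorm w.asIdeal ∣ Ideal.absNorm 𝔪 := Ideal.absNorm_dvd_absNorm_of_le hle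
  rw [absNorm_asIdeal_eq_natGenerator_pow, hw] at hdvd
  haveI : w.asIdeal.IsPrime := w.isPrime
  exact hℓ ((dvd_pow_self _ (Ideal.inertiaDeg_pos (R := 𝓞 ℚ) (q := w.asIdeal)).ne').trans hdvd)

/-- The residue degree read off the cardinality: `N(w) = ℓ_v^{f}` forces `f = f(w ∣ v)`. [cite: NeukirchANT1999, Ch. I (8.2)] -/
theorem eq_inertiaDeg_of_residueCard_eq {v : HeightOneSpectrum (𝓞 ℚ)} {w : HeightOneSpectrum (𝓞 K)} (hw : w.under (𝓞 ℚ) = v) {f : ℕ}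
    (hf : w.residueCard = natGenerator v ^ f) : f = w.asIdeal.inertiaDeg (𝓞 ℚ) := by
  have h := absNorm_asIdeal_eq_natGenerator_pow w
  rw [hw] at h
  exact Nat.pow_right_injective (prime_natGenerator v).two_le (hf.symm.trans h)

/-- **The places of norm `ℓ_v` when `ℓ_v` splits** as `w₁ w₂`: `{w : N(w) = ℓ_v} = {w₁, w₂}`. [cite: NeukirchANT1999, Ch. I (8.2)] -/
theorem setOf_absNorm_asIdeal_eq_of_pair (v : HeightOneSpectrum (𝓞 ℚ)) {w₁ w₂ : HeightOneSpectrum (𝓞 K)}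
    (hS : {w : HeightOneSpectrum (𝓞 K) | w.asIdeal.under (𝓞 ℚ) = v.asIdeal} = {w₁, w₂})
    (h₁ : w₁.asIdeal.inertiaDeg (𝓞 ℚ) = 1) (h₂ : w₂.asIdeal.inertiaDeg (𝓞 ℚ) = 1) :
    {w : HeightOneSpectrum (𝓞 K) | Ideal.absNorm w.asIdeal = natGenerator v} = {w₁, w₂} := by
  ext w
  simp only [Set.mem_setOf_eq, Set.mem_insert_iff, Set.mem_singleton_iff]
  rw [absNorm_eq_natGenerator_iff]
  constructor
  · rintro ⟨w', hw', hunder, -⟩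
    have hww : w' = w := HeightOneSpectrum.ext hw'
    have hmem : w' ∈ ({w₁, w₂} : Set (HeightOneSpectrum (𝓞 K))) := by rw [← hS]; exact hunder
    rw [hww] at hmem
    simpa using hmem
  · have hm₁ : w₁ ∈ {w : HeightOneSpectrum (𝓞 K) | w.asIdeal.under (𝓞 ℚ) = v.asIdeal} := by rw [hS]; exact Set.mem_insert _ _
    have hm₂ : w₂ ∈ {w : HeightOneSpectrum (𝓞 K) | w.asIdeal.under (𝓞 ℚ) = v.asIdeal} := by rw [hS]; exact Set.mem_insert_of_mem _ rfl
    rintro (h | h)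
    · rw [h]; exact ⟨w₁, rfl, hm₁, h₁⟩
    · rw [h]; exact ⟨w₂, rfl, hm₂, h₂⟩

/-- **No place of norm `ℓ_v` when `ℓ_v` is inert.** [cite: Ribet1977Nebentypus, §3, proof of Cor. (3.5) (LNM 601, p. 35)] -/
theorem setOf_absNorm_asIdeal_eq_of_singleton (v : HeightOneSpectrum (𝓞 ℚ)) {w₀ : HeightOneSpectrum (𝓞 K)}
    (hS : {w : HeightOneSpectrum (𝓞 K) | w.asIdeal.under (𝓞 ℚ) = v.asIdeal} = {w₀}) (hw₀ : w₀.asIdeal.inertiaDeg (𝓞 ℚ) = 2) :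
    {w : HeightOneSpectrum (𝓞 K) | Ideal.absNorm w.asIdeal = natGenerator v} = ∅ := by
  ext w
  simp only [Set.mem_setOf_eq, Set.mem_empty_iff_false, iff_false]
  rw [absNorm_eq_natGenerator_iff]
  rintro ⟨w', hw', hunder, hf⟩
  have hmem : w' ∈ ({w₀} : Set (HeightOneSpectrum (𝓞 K))) := by rw [← hS]; exact hunder
  rw [Set.mem_singleton_iff] at hmem
  rw [hmem, hw₀] at hf
  exact absurd hf (by norm_num)

/-- The set of places over `v` in the two spellings (`w.under = v` vs `w.asIdeal.under = v.asIdeal`). [cite: NeukirchANT1999, Ch. I (8.2)] -/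
theorem setOf_asIdeal_under_eq (v : HeightOneSpectrum (𝓞 ℚ)) :
    {w : HeightOneSpectrum (𝓞 K) | w.asIdeal.under (𝓞 ℚ) = v.asIdeal} = {w : HeightOneSpectrum (𝓞 K) | w.under (𝓞 ℚ) = v} := by
  ext w
  simp only [Set.mem_setOf_eq, HeightOneSpectrum.ext_iff, HeightOneSpectrum.under_asIdeal]

variable {p : ℕ} [Fact p.Prime] {S : Set (PadicAlgCl p)}

omit [NumberField K] in
/-- From the pinning `P.map 𝒪.subtype = X − C a`, `θ.HasFrobCharpolyAt w P`: at every arithmetic Frobenius at a prime above `w` the entry `θ(F)₀₀`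
reads `a` in `ℚ̄_p` (rank one: the characteristic polynomial is `X − θ(F)₀₀`; Literature twin of the Summit-side `coe_apply_eq_of_hasFrobCharpolyAt`).
[cite: SerreAbelianLadic1968, Ch. I §2.3] -/
theorem coe_apply_zero_zero_eq_of_hasFrobCharpolyAt (θ : FramedGaloisRep K (padicCoeffIntegers S) 1) {w : HeightOneSpectrum (𝓞 K)}
    {P : Polynomial (padicCoeffIntegers S)} {a : PadicAlgCl p} (hP : P.map (padicCoeffIntegers S).subtype = X - C a)
    (hθ : θ.HasFrobCharpolyAt w P) {𝔔 : Ideal (absIntegers (𝓞 K) K)} (h𝔔 : 𝔔 ∈ w.primesAbove) {F : Field.absoluteGaloisGroup K}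
    (hF : IsArithFrobAt (𝓞 K) F 𝔔) :
    ((((θ F : GL (Fin 1) (padicCoeffIntegers S)) : Matrix (Fin 1) (Fin 1) (padicCoeffIntegers S)) 0 0 : padicCoeffIntegers S) :
      PadicAlgCl p) = a := by
  have hc := hθ 𝔔 h𝔔 F hF
  have htr : ((θ F : GL (Fin 1) (padicCoeffIntegers S)) : Matrix (Fin 1) (Fin 1) (padicCoeffIntegers S)) 0 0 = -(P.coeff 0) := by
    have h1 := Matrix.trace_eq_neg_charpoly_coeff ((θ F : GL (Fin 1) (padicCoeffIntegers S)) : Matrix (Fin 1) (Fin 1) (padicCoeffIntegers S))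
    rw [Matrix.trace_fin_one, Fintype.card_fin] at h1
    change _ = -((FramedRep.charpoly θ F).coeff (1 - 1)) at h1
    rw [hc] at h1
    exact h1
  have hcoeff : ((P.coeff 0 : padicCoeffIntegers S) : PadicAlgCl p) = -a := by
    have h := congrArg (fun Q : Polynomial (PadicAlgCl p) => Q.coeff 0) hP
    simp only [Polynomial.coeff_map, Polynomial.coeff_sub, Polynomial.coeff_X_zero, Polynomial.coeff_C_zero, zero_sub] at h
    exact h
  rw [htr]
  push_cast
  rw [hcoeff, neg_neg]

/-- ★★★ **THE EULER FACTOR OF THE `Γ₀` CM NEWFORM THROUGH THE `p`-ADIC CHARACTER AT A GOOD PRIME `ℓ ∤ p·|d_K|·N𝔪`, `ℓ ∤ M`** — the conclusion of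
`Ribet1977_cmNewform_gamma0_eulerFactor_padicCharacter` at such `ℓ`, PROVED from its hypotheses: every `w ∋ ℓ` is prime to `p𝔪`, so the pinning gives
`θ` unramified at `w` with `θ(Frob_w)₀₀ = e⁻¹ψ(w)` and `Tℓ` = all places over `ℓ`; `ι a_ℓ(g) = e⁻¹ Σ_{Nw=ℓ} ψ(w)`; and by the decomposition law + `η = φ`
(`ψ((ℓ)) = κ(ℓ)·ℓ`, `κ(ℓ) = 1` split, `−1` inert; `ℓ ∤ d_K` unramified): split `(1 − ψ(w)X)(1 − ψ(w̄)X) = 1 − (ψ(w)+ψ(w̄))X + ℓX²`, inert `1 − ψ((ℓ))X² = 1 + ℓX²`.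
[cite: Ribet1977Nebentypus, §3, Thm. (3.4) and Cor. (3.5) (LNM 601, pp. 34–35)] [cite: NeukirchANT1999, Ch. I (8.2)] [cite: Cox2013, §1.C Lemma 1.14] -/
theorem eulerFactor_padicCharacter_of_not_dvd (hK2 : Module.finrank ℚ K = 2) (htc : IsTotallyComplex K) (σ : K →+* ℂ) {𝔪 : Ideal (𝓞 K)}
    {ψ : HeightOneSpectrum (𝓞 K) → ℂ} (hψ : IsGrossencharakter 𝔪 (embType σ) (embTypeConj σ) ψ)
    (hψpow : ∀ n : ℕ, Odd n → n.Coprime ((discr K).natAbs * Ideal.absNorm 𝔪) →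
      idealPow K ψ (Ideal.span {(n : 𝓞 K)}) = (jacobiSym (discr K) n : ℂ) * (n : ℂ) ^ (2 - 1))
    (e : PadicAlgCl p ≃+* ℂ) {M : ℕ} [NeZero M] (g : CuspForm (Gamma0 M) 2) (ι : coeffField g →+* PadicAlgCl p)
    (hcoeffψ : ∀ ℓ : ℕ, ℓ.Prime → ¬ ℓ ∣ (discr K).natAbs * Ideal.absNorm 𝔪 →
      embCoeff g ι ℓ = e.symm (∑ᶠ (w : HeightOneSpectrum (𝓞 K)) (_ : Ideal.absNorm w.asIdeal = ℓ), ψ w))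
    (θ : FramedGaloisRep K (padicCoeffIntegers S) 1)
    (hθ : ∀ w : HeightOneSpectrum (𝓞 K), ((p : ℕ) : 𝓞 K) ∉ w.asIdeal → ¬ 𝔪 ≤ w.asIdeal →
      θ.IsUnramifiedAt w ∧ ∃ P : Polynomial (padicCoeffIntegers S), P.map (padicCoeffIntegers S).subtype = X - C (e.symm (ψ w)) ∧ θ.HasFrobCharpolyAt w P)
    {ℓ : ℕ} (hℓ : ℓ.Prime) (hℓp : ℓ ≠ p) (hℓD : ¬ ℓ ∣ (discr K).natAbs * Ideal.absNorm 𝔪) (hℓM : ¬ ℓ ∣ M)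
    (Tℓ : Finset (HeightOneSpectrum (𝓞 K))) (φ : HeightOneSpectrum (𝓞 K) → Field.absoluteGaloisGroup K) (f : HeightOneSpectrum (𝓞 K) → ℕ)
    (hT : ∀ w, w ∈ Tℓ ↔ (((ℓ : ℕ) : 𝓞 K) ∈ w.asIdeal ∧ θ.IsUnramifiedAt w))
    (hφ : ∀ w ∈ Tℓ, ∃ 𝔓 ∈ w.primesAbove, IsArithFrobAt (𝓞 K) (φ w) 𝔓) (hf : ∀ w ∈ Tℓ, w.residueCard = ℓ ^ f w) :
    (1 - C (embCoeff g ι ℓ) * X + (if ℓ ∣ M then 0 else C ((ℓ : ℕ) : PadicAlgCl p)) * (X : (PadicAlgCl p)[X]) ^ 2) =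
      ∏ w ∈ Tℓ, (1 - C ((((θ (φ w) : GL (Fin 1) (padicCoeffIntegers S)) : Matrix (Fin 1) (Fin 1) (padicCoeffIntegers S)) 0 0 :
          padicCoeffIntegers S) : PadicAlgCl p) * (X : (PadicAlgCl p)[X]) ^ f w) := by
  classical
  haveI := htc
  -- the rational place `v` under `ℓ`
  obtain ⟨v, hv⟩ : ∃ v : HeightOneSpectrum (𝓞 ℚ), (primesEquiv v : ℕ) = ℓ := ⟨primesEquiv.symm ⟨ℓ, hℓ⟩, by rw [Equiv.apply_symm_apply]⟩
  subst hv
  have hℓv : ((primesEquiv v : ℕ)) = natGenerator v := rfl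
  rw [hℓv] at hℓp hℓD hℓM hT hf ⊢
  rw [if_neg hℓM]
  have hℓD' : ¬ natGenerator v ∣ (discr K).natAbs := fun h ↦ hℓD (h.mul_right _)
  have hℓ𝔪 : ¬ natGenerator v ∣ Ideal.absNorm 𝔪 := fun h ↦ hℓD (h.mul_left _)
  -- every place over `v` is good for `θ`: prime to `p𝔪`
  have hover : ∀ w : HeightOneSpectrum (𝓞 K), ((natGenerator v : ℕ) : 𝓞 K) ∈ w.asIdeal ↔ w.under (𝓞 ℚ) = v :=
    fun w ↦ (under_eq_iff_natCast_primesEquiv_mem w v).symm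
  have hgood : ∀ w : HeightOneSpectrum (𝓞 K), w.under (𝓞 ℚ) = v →
      θ.IsUnramifiedAt w ∧ ∃ P : Polynomial (padicCoeffIntegers S), P.map (padicCoeffIntegers S).subtype = X - C (e.symm (ψ w)) ∧ θ.HasFrobCharpolyAt w P :=
    fun w hw ↦ hθ w (natCast_not_mem_asIdeal_of_natCast_mem hℓ Fact.out hℓp ((hover w).mpr hw)) (not_le_asIdeal_of_not_dvd_absNorm hℓ𝔪 hw)
  have hTv : ∀ w, w ∈ Tℓ ↔ w.under (𝓞 ℚ) = v := fun w ↦ by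
    rw [hT, hover]
    exact ⟨fun h ↦ h.1, fun h ↦ ⟨h, (hgood w h).1⟩⟩
  have hval : ∀ w ∈ Tℓ, ((((θ (φ w) : GL (Fin 1) (padicCoeffIntegers S)) : Matrix (Fin 1) (Fin 1) (padicCoeffIntegers S)) 0 0 :
      padicCoeffIntegers S) : PadicAlgCl p) = e.symm (ψ w) := fun w hw ↦ by
    obtain ⟨-, P, hPmap, hP⟩ := hgood w ((hTv w).mp hw)
    obtain ⟨𝔓, h𝔓, hF⟩ := hφ w hw
    exact coe_apply_zero_zero_eq_of_hasFrobCharpolyAt θ hPmap hP h𝔓 hF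
  -- the Kronecker character and `ψ((ℓ)) = κ(ℓ)·ℓ`
  obtain ⟨κ, -, -, -, hκJ, hζ⟩ := exists_kroneckerChar_odd_jacobiSym_dedekindZeta (K := K) hK2
  have hψG : IsGrossencharakter 𝔪 (fun w => (((2 : ℕ) : ℤ) - 1) * embType σ w) (fun w => (((2 : ℕ) : ℤ) - 1) * embTypeConj σ w) ψ := by
    convert hψ using 2 <;> norm_num
  have hcop : (natGenerator v).Coprime ((discr K).natAbs * Ideal.absNorm 𝔪) := (Nat.Prime.coprime_iff_not_dvd (prime_natGenerator v)).mpr hℓD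
  have hψℓ : idealPow K ψ (Ideal.span {((natGenerator v : ℕ) : 𝓞 K)}) = κ (natGenerator v) * (natGenerator v : ℂ) :=
    by rw [idealPow_span_natCast_eq_kroneckerChar_mul_pow hK2 σ (k := 2) (by norm_num) hκJ hψG hψpow hcop, pow_one]
  have hsum := hcoeffψ (natGenerator v) (prime_natGenerator v) hℓD
  -- the finite sum over the places of norm `ℓ` is a sum over a set
  have hsum' : (∑ᶠ (w : HeightOneSpectrum (𝓞 K)) (_ : Ideal.absNorm w.asIdeal = natGenerator v), ψ w) =
      ∑ᶠ w ∈ {w : HeightOneSpectrum (𝓞 K) | Ideal.absNorm w.asIdeal = natGenerator v}, ψ w := rfl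
  rw [hsum'] at hsum
  -- the decomposition of `ℓ` in `K`
  rcases placesOver_trichotomy_of_finrank_eq_two K hK2 v with ⟨w₁, w₂, hne, hS, hall⟩ | ⟨w₀, hS, -, hf2⟩ | ⟨w₀, hS, he2, -⟩
  · -- SPLIT: `Tℓ = {w₁, w₂}`, both of degree one
    have hS' : {w : HeightOneSpectrum (𝓞 K) | w.asIdeal.under (𝓞 ℚ) = v.asIdeal} = {w₁, w₂} := by rw [setOf_asIdeal_under_eq, hS]
    have hw₁ : w₁.under (𝓞 ℚ) = v := by have : w₁ ∈ ({w₁, w₂} : Set _) := Set.mem_insert _ _; rw [← hS] at this; exact this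
    have hw₂ : w₂.under (𝓞 ℚ) = v := by have : w₂ ∈ ({w₁, w₂} : Set _) := Set.mem_insert_of_mem _ rfl; rw [← hS] at this; exact this
    have hT₁ : w₁ ∈ Tℓ := (hTv w₁).mpr hw₁
    have hT₂ : w₂ ∈ Tℓ := (hTv w₂).mpr hw₂
    have hTeq : Tℓ = {w₁, w₂} := by
      ext w
      rw [hTv, Finset.mem_insert, Finset.mem_singleton]
      have h := Set.ext_iff.mp hS w
      simp only [Set.mem_setOf_eq, Set.mem_insert_iff, Set.mem_singleton_iff] at h
      exact h
    have hf₁ : f w₁ = 1 := (eq_inertiaDeg_of_residueCard_eq hw₁ (hf w₁ hT₁)).trans (hall w₁ hw₁).2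
    have hf₂ : f w₂ = 1 := (eq_inertiaDeg_of_residueCard_eq hw₂ (hf w₂ hT₂)).trans (hall w₂ hw₂).2
    -- `a_ℓ = ψ(w₁) + ψ(w₂)`, `ψ(w₁) ψ(w₂) = ℓ`
    rw [setOf_absNorm_asIdeal_eq_of_pair v hS' (hall w₁ hw₁).2 (hall w₂ hw₂).2, finsum_mem_pair hne] at hsum
    have hprod : ψ w₁ * ψ w₂ = (natGenerator v : ℂ) := by
      rw [← idealPow_span_natGenerator_of_pair hK2 ψ v hne hS' (hall w₁ hw₁).2 (hall w₂ hw₂).2, hψℓ,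
        kroneckerChar_natGenerator_eq_one_of_pair hζ v hne hS' (hall w₁ hw₁).2 (hall w₂ hw₂).2, one_mul]
    have hℓe : ((natGenerator v : ℕ) : PadicAlgCl p) = e.symm (ψ w₁) * e.symm (ψ w₂) := by rw [← map_mul, hprod, map_natCast]
    rw [hTeq, Finset.prod_pair hne, hval w₁ hT₁, hval w₂ hT₂, hf₁, hf₂, hsum, hℓe, map_add, map_add, map_mul]
    ring
  · -- INERT: `Tℓ = {w₀}` of degree two, no place of norm `ℓ`
    have hS' : {w : HeightOneSpectrum (𝓞 K) | w.asIdeal.under (𝓞 ℚ) = v.asIdeal} = {w₀} := by rw [setOf_asIdeal_under_eq, hS]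
    have hw₀ : w₀.under (𝓞 ℚ) = v := by have : w₀ ∈ ({w₀} : Set _) := Set.mem_singleton _; rw [← hS] at this; exact this
    have hT₀ : w₀ ∈ Tℓ := (hTv w₀).mpr hw₀
    have hTeq : Tℓ = {w₀} := by
      ext w
      rw [hTv, Finset.mem_singleton]
      have h := Set.ext_iff.mp hS w
      simp only [Set.mem_setOf_eq, Set.mem_singleton_iff] at h
      exact h
    have hf₀ : f w₀ = 2 := (eq_inertiaDeg_of_residueCard_eq hw₀ (hf w₀ hT₀)).trans hf2
    rw [setOf_absNorm_asIdeal_eq_of_singleton v hS' hf2, finsum_mem_empty] at hsum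
    have hψw₀ : ψ w₀ = -(natGenerator v : ℂ) := by
      rw [← idealPow_span_natGenerator_of_singleton hK2 ψ v hS' hf2, hψℓ, kroneckerChar_natGenerator_eq_neg_one_of_singleton hζ v hS' hf2,
        neg_one_mul]
    have hval₀ : ((((θ (φ w₀) : GL (Fin 1) (padicCoeffIntegers S)) : Matrix (Fin 1) (Fin 1) (padicCoeffIntegers S)) 0 0 :
        padicCoeffIntegers S) : PadicAlgCl p) = -((natGenerator v : ℕ) : PadicAlgCl p) := by
      rw [hval w₀ hT₀, hψw₀, map_neg, map_natCast]
    have hemb : embCoeff g ι (natGenerator v) = 0 := by rw [hsum, map_zero]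
    rw [hTeq, Finset.prod_singleton, hval₀, hf₀, hemb, map_zero, zero_mul, sub_zero, map_neg, neg_mul, sub_neg_eq_add]
  · -- RAMIFIED: impossible, `ℓ ∤ d_K`
    exfalso
    have hw₀ : w₀.under (𝓞 ℚ) = v := by have : w₀ ∈ ({w₀} : Set _) := Set.mem_singleton _; rw [← hS] at this; exact this
    have h := natGenerator_dvd_discr_of_ramificationIdx_eq_two K w₀ he2
    rw [hw₀] at h
    exact hℓD' (Int.ofNat_dvd_left.mp h)

end Good

end Literature.NumberTheory.EllipticCurves.ModularForms

end
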